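import Mathlib
import HarnessLib
import HarnessLib.Audit
import Summits.HubbardSuperconductivity.Statement
import Literature.MathematicalPhysics.QuantumLattice.HeisenbergModel
import HarnessLib.Audit.Status.Attr

/-!
Route: AnisotropyChord

# Route AnisotropyChord — concavity between the two SU(2) points: one chord in the Ising anisotropy
carries half-filled XY order to the plaquette lock-in Δ_eff≈-0.99; dress at δ=1/4, continue t'↑1

X = CHORD ∧ DRESS ∧ CONTINUE (card anisotropy-chord-xxz, realised on the plaquette dictionary of
card plaquette-boson-kls-anchor /
route PlaquetteBoson). Conventions of route PlaquetteBoson: H_M(Δ) = xxzHamiltonian 1 (torusGraph 2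
M) (-1) Δ = -Σ(SˣSˣ+SʸSʸ+ΔSᶻSᶻ) on the
even torus (ℤ/Mℤ)² (= hard-core bosons, hopping ½, n.n. repulsion V = -Δ), Λ(ψ) = Re⟨ψ, S⁺_tot
S⁻_tot ψ⟩ = ‖S⁻_tot ψ‖² (the k=0 condensate ⟨B†B⟩) of a
normalised S^z_tot = 0 (half-filled) sector ground state; Δ = +1 is the Heisenberg FERROMAGNET (Λ =
(M²/2)(M²/2+1) exactly), Δ = 0 the KLS point,
Δ = -1 the Heisenberg ANTIFERROMAGNET; the plaquette pair gas sits at Δ_eff(U) ≈ -0.99.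
(i) CHORD (the new mechanism): for every even M ≥ 4 the half-filled condensate lies above the chord
from the KLS point to the AF point,
(1+Δ)·Λ_M(0) ≤ Λ_M(Δ) for Δ ∈ [-1,0] (ChordXY; the weak form of "Λ_M is concave in Δ on [-1,1]",
support Concavity), and — reflection-positivity-FREE —
above the chord from the exact FM value, ((1+Δ)/2)(M²/2)(M²/2+1) ≤ Λ_M(Δ) for Δ ∈ [-1,1] (ChordFM).
Either chord (the first together with the KLS anchor in
sector form, SectorAnchorXY = stmt-0977) yields planar order ≥ c(Δ)M⁴ at EVERY easy-plane anisotropy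
Δ ∈ (-1,0] (HalfFilledOrder = PlaquetteBoson's crux
PbHalfFilledXYOrder, stmt-0906) by three lines of arithmetic (supports ChordToOrderXY /
ChordToOrderFM).
(ii) DRESS: half-filled planar order at every Δ ∈ (-1,0] ⇒ the checkerboard Hubbard torus (2×2
plaquettes, t=1 inside, t' between, 4 ∣ L) has d_{x²-y²}
pair-field order ⟨Δ_d†Δ_d⟩ ≥ cL⁴ in every (N_L, S^z=0)-sector ground state at doping δ = 1/4 (boson
half filling) for small t' (DressHalfFilled :
HalfFilledOrder → AnchorOrder, AnchorOrder = PlaquetteBoson's PbAnchorOrder, stmt-0905).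
(iii) CONTINUE t' ↑ 1 to hubbardTorus 2 L 1 U (Continuation = PbContinuation, stmt-0907; the bet
shared with PlaquetteBoson).
Lean: `ChordXY ∧ SectorAnchorXY ∧ DressHalfFilled ∧ Continuation`

## Assembly
ChordXY and SectorAnchorXY give HalfFilledOrder by ChordToOrderXY (real arithmetic + existence of a
sector ground state at Δ = 0); DressHalfFilled turns it
into AnchorOrder = ∃ U, δ, t₀, … (PbAnchorOrder); Continuation U δ hU hδ ⟨t₀, …⟩ is then literally
the summit's conclusion at (U,δ), so
HubbardSuperconductivity := ⟨U, hU, δ, hδ, Continuation …⟩ — this last step is PlaquetteBoson's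
PROVED Assembly (evidence AssemblyPlaquette.lean on
stmt-0909). Sketch.lean (rc 0): `example (glue : ChordToOrderXY) (asmPb : AnchorOrder → Continuation
→ HubbardSuperconductivity) : Assembly :=
fun hA hS hD hC => asmPb (hD (glue hA hS)) hC`. RP-free variant (one restate if ChordXY dies and
ChordFM lives): ChordFM → DressHalfFilled → Continuation →
HubbardSuperconductivity via ChordToOrderFM.

Rationale: WHY THIS LINE. The plaquette dictionary (YaoTsaiKivelson2007, TsaiKivelson2006; routes
PlaquetteBoson / PairBosonDome) needs planar order of the S=½ XXZ pair gas at the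
LOCKED-IN anisotropy Δ_eff(U) ≈ -0.99 (card plaquette-pseudospin-lockin), outside every proved
window (KLS1988PRL at Δ = 0, KuboKishi1988 /
doi:10.1143/jpsj.58.1027 for |Δ| ≲ 0.13–0.2) and 1% away from Lieb's open S=½ Heisenberg problem;
the existing routes can only attack it by closing an infrared
bound AT Δ_eff within ~1% slack (card uv-ir-handshake-lp-kls). This line TRANSPORTS order along the
anisotropy instead: Griffiths' 1967 architecture
(doi:10.1063/1.1705219: order at one point + a correlation inequality ⇒ order on an interval) with a
SECOND-order, GHS-type inequality (doi:10.1063/1.1665211,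
concavity) in the coupling replacing the first-order monotonicity that is useless here (monotonicity
in Δ only moves order to the easier, ferromagnetic side;
it is known for classical rotators, doi:10.1088/0305-4470/9/10/019, and open for S=½ beyond two spin
directions, BenassiLeesUeltschi2016) — a chord from the
KLS point (or, RP-free, from the exactly solvable ferromagnet, Tóth's maximum
doi:10.1007/BF01329865) reaches every easy-plane anisotropy Δ ∈ (-1,1), in particular the AF side
(-1,0] where Δ_eff sits,
with 60–75% observed margin (card ED: Λ(Δ=-0.9)/Λ(0) = 0.77 on 4×4, 0.76 on √20×√20, against the
0.10 the chord needs). Imported areas: correlation-inequality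
architecture of classical lattice spin systems (Griffiths/GHS) transplanted to a ground-state order
parameter as a function of a coupling; stoquastic
path-integral probability (Λ_β = Z_worm/Z is a ratio of Laplace transforms in V, (log Λ_β)'' =
Var_worm(𝒜) - Var_closed(𝒜): concavity = a variance
comparison, the habitat of coupling/FKG proofs); linear spin-wave theory only as a plausibility
check (this session: depletion slope 1/(4π) < chord slope 1/8
at the FM end; m² = 0.194 vs chord demand 0.125 at the XY point); certified ED as the falsifier.
Negatives index empty; no prior route has a statement
comparing ground states at two different anisotropies.

RANKED CRUXES. #2 ChordXY (crux) — TIER A CHORD (card K1, load-bearing weak form (CD) of concavity):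
for every even M ≥ 4, every Δ ∈ [-1,0], every normalised S^z_tot=0 sector ground state ψ₀ of H_M(0)
(KLS point) and ψ of H_M(Δ): (1+Δ)·Λ(ψ₀) ≤ Λ(ψ). Equality side conditions: Δ = 0 trivial (sector GS
unique by Perron–Frobenius, H stoquastic), Δ = -1 reads 0 ≤ ‖S⁻ψ‖². With SectorAnchorXY it gives Λ ≥
(1+Δ)c M⁴, i.e. HalfFilledOrder with margin (1+Δ_eff)c ≈ 10⁻²c at the plaquette anisotropy. ED
(card): all second differences of Λ_M(Δ) negative on [-1.1,1.2] (4×4, step 0.05) and [-1.0,1.1]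
(√20×√20, step 0.1); chord margins Λ(-0.9)/Λ(0) = 0.767, 0.760 vs 0.1 needed. Intended engine:
Concavity (support) via the finite-β variance-comparison identity, then β→∞ at fixed M. [difficulty:
open-problem] (why it might fail: No sign principle for Λ''(Δ) (a third-order response) is known;
the inequality holds only in the ordered d=2 phase (d=1 rings are CONVEX by Luttinger scaling,
dilute fillings turn convex); the literal all-M form could be dented at intermediate M near Δ→-1⁺ by
the finite-size spin-flop rounding.) [KLS1988PRL, KuboKishi1988, doi:10.1143/jpsj.58.1027,
doi:10.1063/1.1665211, doi:10.1088/0305-4470/9/10/019, BenassiLeesUeltschi2016,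
doi:10.1143/jpsj.57.4351, doi:10.1103/physrevb.60.6588,
idea:HubbardSuperconductivity/HubbardSuperconductivity/anisotropy-chord-xxz]
#3 ChordFM (crux) — TIER B CHORD, reflection-positivity-FREE (card K2): for every even M ≥ 4, every
Δ ∈ [-1,1] and every normalised S^z_tot=0 sector ground state ψ of H_M(Δ): ((1+Δ)/2)·(M²/2)(M²/2+1)
≤ Λ(ψ) — the chord from the exact ferromagnetic value Λ_M(1) = (M²/2)(M²/2+1) (FerroPointValue;
Tóth's universal maximum of ⟨B†B⟩ on the sector) to 0 at the AF point. Alone it gives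
HalfFilledOrder with the explicit constant c(Δ) = (1+Δ)/8 (ChordToOrderFM) — planar LRO of the S=½
XXZ ground state for every Δ ∈ (-1,1) and m²_xy ≥ 1/8 at the XY point WITHOUT reflection positivity;
it can replace ChordXY ∧ SectorAnchorXY in the Assembly (one restate). ED (card): Λ/M⁴·… 4×4:
Λ(1)=72 (exact), Λ(0)=68.0 ≥ 36, Λ(-0.9)=52.1 ≥ 3.6; √20: 110 (exact), 102.9 ≥ 55, 78.3 ≥ 5.5. M=∞
check (LSW, this session): slope at the FM end 0.064–0.080 < 0.125. [difficulty: open-problem] (why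
it might fail: At M=∞ the curve leaves the FM point with slope -C against the chord's -1/8 (in units
M⁴): LSW gives C=1/(4π)≈0.08, only ~40% slack, and S=½ magnon-interaction corrections are
uncontrolled; 16–20-site ED cannot see this regime (needs 1-Δ ≲ π²/M², M ≳ 8).)
[doi:10.1007/BF01329865, Toth1990, Penrose1991, Tasaki2020, doi:10.1103/physrevb.60.6588,
AizenmanEtAl2004, idea:HubbardSuperconductivity/HubbardSuperconductivity/anisotropy-chord-xxz]
#4 DressHalfFilled (crux) — DRESSING LEMMA at boson half filling, implication form (the fermionic
half of PlaquetteBoson's PbAnchorOrder with its bosonic input made an explicit hypothesis):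
HalfFilledOrder (planar order ≥ c(Δ)M⁴ of every half-filled sector GS of H_M(Δ), eventually in even
M, for EVERY Δ ∈ (-1,0]) → AnchorOrder (∃ U > 0, δ ∈ (0,1/2), t₀ > 0: for t' ∈ (0,t₀), eventually in
L ∈ 4ℕ, every normalised (N_L,0)-sector GS of the checkerboard torus hamiltonian(G_intra,1,U) +
hamiltonian(G_inter,t',0), N_L = 2⌊(1-δ)L²/2⌋, has Re⟨Δ_d†Δ_d⟩ ≥ c(t')L⁴). Intended proof: pick U₀
in the pair-binding window with certified Δ_eff(U₀) = -v(U₀)/2j(U₀) ∈ (-1,0] (ED: U₀ ∈ [1,2]) and δ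
= 1/4 (hole pairs = half-filled hard-core bosons on the (L/2)-torus, no monotone depletion needed);
second-order Schrieffer–Wolff H_L(t',U₀) = t'²j·H_{L/2}(Δ_eff) ⊕ high + O(t'³); instantiate the
hypothesis at Δ_eff; show the order survives the U(1)-symmetric non-RP remainder and projects onto
Δ_d with O(1) overlap (B1g pair wavefunction of the plaquette). [difficulty: XL] (why it might fail:
Needs a U with CERTIFIED Δ_eff(U)∈(-1,0] and pair binding (ED, uncertified: Δ_eff=-0.986 at U=1,
-0.993 at U=2, crossing -1 at U_s≈2.7); then L-uniform survival of gapless U(1) order under the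
non-RP O(t'³) Schrieffer–Wolff remainder — no stability theorem exists.) [YaoTsaiKivelson2007,
TsaiKivelson2006, doi:10.1103/physrevb.65.104508, AizenmanEtAl2004, KLS1988PRL,
idea:HubbardSuperconductivity/HubbardSuperconductivity/plaquette-pseudospin-lockin]
#5 Continuation (crux) — CONTINUATION t' ↑ 1 (verbatim PlaquetteBoson.PbContinuation, stmt-0907,
shared): for all U > 0, δ ∈ (0,1/2): [small-t' every-GS d-wave order of the checkerboard torus as in
AnchorOrder] ⇒ [the summit's conclusion at (U,δ): every admissible ground-state sequence of
hubbardTorus 2 L 1 U (= the t'=1 member) has HasLongRangeOrder of torusPullback (pairFieldCorr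
dWaveFormFactor ψ) along even sides]. The bet of the whole plaquette programme; this route adds
nothing to it and uses it at (U₀ ≈ 1–2, δ = 1/4), where weak-coupling RG places the pure model in
the d_{x²-y²} phase (DengEtAl2015 Fig. 1, n = 0.75). [deps: DressHalfFilled] [difficulty:
open-problem] (why it might fail: ∀(U,δ) implication with no tool (no continuity of GS order in t');
physically false in corners where small-t' pair order exists but the pure GS is not d_{x²-y²} (U≤4,
δ>0.4: d_xy/p; δ→0⁺: AF; U≈8, δ=1/8: stripes); 1st-order d-CDW on the t' path near U_s.)
[DoluweeraEtAl2008, QinEtAl2020, DengEtAl2015, YaoTsaiKivelson2007, doi:10.1103/physrevb.83.054508,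
Literature.Barriers.HubbardSuperconductivity.PureModelStripeCompetition]
#9 SectorAnchorXY (support) — KLS ANCHOR IN SECTOR FORM, Δ = 0 (verbatim
PlaquetteBoson.PbXYSectorAnchor, stmt-0977, shared; provable now): ∃ c > 0, M₀: for even M ≥ M₀
every normalised S^z_tot=0 sector GS of H_M(0) has Λ ≥ cM⁴. From the PROVED tree fact
Literature.MathematicalPhysics.QuantumLattice.kennedy_lieb_shastry_xy_ground_holds (tracial GS
functional, d=2, n=1) + 'the global GS of the hard-core gas on the even torus is unique and half
filled' (AizenmanEtAl2004; LiebMattis1962) + Perron–Frobenius in the sector + S⁺S⁻ = (Sˣ)²+(Sʸ)²+Sᶻ.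
Needed by Tier A only. [difficulty: provable-now] [KLS1988PRL, AizenmanEtAl2004,
LiebSeiringerSolovejYngvason2005, LiebMattis1962,
Literature.MathematicalPhysics.QuantumLattice.kennedy_lieb_shastry_xy_ground_holds]
#9 HalfFilledOrder (support) — THE MEETING NODE (verbatim PlaquetteBoson.PbHalfFilledXYOrder,
stmt-0906 — a rank-4 CRUX there, derived glue here): ∀ Δ ∈ (-1,0] ∃ c > 0 ∃ M₀ ∀ even M ≥ M₀: every
normalised S^z_tot=0 sector GS of H_M(Δ) has Λ ≥ cM⁴. In this route it FOLLOWS from ChordXY ∧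
SectorAnchorXY (ChordToOrderXY) or from ChordFM alone (ChordToOrderFM); it is the hypothesis of
DressHalfFilled. Known only for |Δ| ≲ 0.2 (RP closures). [difficulty: L] [KLS1988PRL, KuboKishi1988,
doi:10.1143/jpsj.58.1027, doi:10.1051/jp1:1991109]
#9 AnchorOrder (support) — THE ANCHOR THEOREM (verbatim PlaquetteBoson.PbAnchorOrder, stmt-0905 — a
rank-3 crux there, derived here): ∃ U > 0, δ ∈ (0,1/2), t₀ > 0 ∀ t' ∈ (0,t₀) ∃ c > 0 ∃ L₀ ∀ L ≥ L₀,
4 ∣ L: every normalised (N_L, S^z=0)-sector GS of the checkerboard Hubbard torus has Re⟨Δ_d†Δ_d⟩ ≥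
cL⁴. Here = DressHalfFilled applied to HalfFilledOrder (δ = 1/4 intended); it is the hypothesis
Continuation consumes. [difficulty: XL] [YaoTsaiKivelson2007, TsaiKivelson2006, KLS1988PRL]
#9 FerroPointValue (support) — THE EXACT FERROMAGNETIC ENDPOINT (provable now; the Tier B anchor and
a convention check): for every even M (NeZero) every normalised S^z_tot=0 sector GS ψ of H_M(1) = -Σ
𝐒_x·𝐒_y has Λ(ψ) = (M²/2)(M²/2+1): the sector GS is the unique S_tot = M²/2, S^z = 0 state (each
bond -𝐒·𝐒 ≥ -1/4 with equality iff triplet; connected torus ⇒ fully symmetric; Perron–Frobenius),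
and S⁺S⁻|S,0⟩ = S(S+1)|S,0⟩. Tóth 1991: this is also the maximum of ⟨B†B⟩ over the sector.
[difficulty: provable-now] [doi:10.1007/BF01329865, Tasaki2020, LiebMattis1962]
#9 Concavity (support) — THE STRUCTURAL PARENT (CC) (card): for every even M ≥ 4, Δ ↦ Λ_M(Δ) is
CONCAVE on [-1,1] — three-point form: -1 ≤ Δ₁ ≤ Δ₂ ≤ Δ₃ ≤ 1, sector GS ψᵢ of H_M(Δᵢ) ⇒ (Δ₃-Δ₂)Λ(ψ₁)
+ (Δ₂-Δ₁)Λ(ψ₃) ≤ (Δ₃-Δ₁)Λ(ψ₂). Implies ChordXY (points -1, Δ, 0 and Λ ≥ 0) and, with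
FerroPointValue, ChordFM (points -1, Δ, 1). Equivalent finite-β form: (log Λ_β)'' = Var_worm(𝒜) -
Var_closed(𝒜) ≤ -((log Λ_β)')², 𝒜 = ∫₀^β Σ n_p n_q — the intended proof engine. Filed as support so
that a positive second difference at some M (which kills (CC) but not necessarily the chords) does
not break the route; refuters may still test it first (it is the sharpest form). [difficulty:
open-problem] [doi:10.1063/1.1665211, doi:10.1007/bf01009750,
idea:HubbardSuperconductivity/HubbardSuperconductivity/anisotropy-chord-xxz]
#9 ChordToOrderXY (support) — TIER A GLUE (provable now, ~150 lines): ChordXY → SectorAnchorXY →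
HalfFilledOrder. Proof: given Δ ∈ (-1,0], take c' = (1+Δ)c > 0 and M₀' = max(M₀,4); for even M ≥ M₀'
pick a normalised sector GS ψ₀ of H_M(0) (exists: Hermitian matrix on the nonempty invariant sector,
minEnergyOn attained; cf. LiebMattisSectorPF), then Λ(ψ) ≥ (1+Δ)Λ(ψ₀) ≥ (1+Δ)cM⁴. [difficulty:
provable-now] [KLS1988PRL,
idea:HubbardSuperconductivity/HubbardSuperconductivity/anisotropy-chord-xxz]
#9 ChordToOrderFM (support) — TIER B GLUE (provable now, ~60 lines): ChordFM → HalfFilledOrder with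
c = (1+Δ)/8 and M₀ = 4, since (M²/2)(M²/2+1)/2 ≥ M⁴/8. This is the RP-free substitute for ChordXY ∧
SectorAnchorXY in the Assembly. [difficulty: provable-now] [doi:10.1007/BF01329865,
idea:HubbardSuperconductivity/HubbardSuperconductivity/anisotropy-chord-xxz]

TWO-LAYER PLAN. Foreseen glued splits (nothing filed now): ChordXY ⇐ VarianceComparison (finite β,
M: Var_closed(𝒜) - Var_worm(𝒜) ≥ (⟨𝒜⟩_closed - ⟨𝒜⟩_worm)², i.e.
log-concavity of Λ_β in Δ) → GroundStateLimit (β → ∞ at fixed M to the S^z=0 sector GS, concavity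
survives pointwise limits) → ChordXY; DressHalfFilled ⇐
PlaquetteData (certified one/two-plaquette ED: Δ_pb(U₀) > 0, B1g selection, j(U₀), v(U₀), Δ_eff(U₀)
∈ (-1,0]) → SchriefferWolffDress (operator identity +
survival of the XXZ order under the O(t'³) U(1)-symmetric remainder + B1g overlap) →
DressHalfFilled; Continuation: no decomposition (tool-less bet; numerics
first). If ChordFM closes first, the Assembly is restated on it and SectorAnchorXY drops out.

KILL CRITERIA. (1) A certified violation of BOTH chords at half filling — an even M ≥ 4 and Δ with
(1+Δ)Λ_M(0) > Λ_M(Δ) on [-1,0] AND ((1+Δ)/2)(M²/2)(M²/2+1) > Λ_M(Δ) on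
[-1,1] (interval-arithmetic ED / DMRG with certified bounds) ⇒ restate ONCE in eventual-in-M form (∃
M₀) if the violation is a small-M shell effect with the
K=∞ evidence intact; refuted again, or violated at the LARGEST accessible M with growing defect ⇒
close `refuted:ChordXY` (mechanism dead). Only ONE chord
refuted ⇒ restate the Assembly on the survivor (ChordFM+ChordToOrderFM or ChordXY+SectorAnchorXY),
not a closure. A positive second difference alone
(¬Concavity) flags but does not close. (2) Certified plaquette ED showing Δ_eff(U) ∉ (-1,0] for
every U with pair binding (lock-in on the Ising side
everywhere) ⇒ DressHalfFilled's hypothesis never meets the dictionary ⇒ close the route, keep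
ChordXY/ChordFM/Concavity as Literature targets (planar order of
the S=½ XXZ model for all Δ ∈ (-1,0] is of independent value). (3) Continuation refuted (shared with
PlaquetteBoson) ⇒ close. (4) HalfFilledOrder (stmt-0906)
proved by another engine (uv-ir LP) ⇒ this route is superseded for the summit (close `superseded
--by route-HubbardSuperconductivity-PlaquetteBoson`);
DressHalfFilled/AnchorOrder proved elsewhere ⇒ same.

NOT DECOMPOSED YET. The variance-comparison engine behind Concavity (finite-β worm representation,
the β → ∞ limit); the certified plaquette data and the Schrieffer–Wolff /
stability glue under DressHalfFilled (needs the certified U₀ first); other boson fillings (δ ≠ 1/4)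
— available by composing HalfFilledOrder with PairBosonDome's
MonotoneDepletionXXZ (stmt-0920) if the continuation bet prefers another doping, deliberately NOT
imported here so that this route rests on ONE new bosonic
inequality; the eventual-in-M weakenings of the chords (filed only if the literal forms die on a
small torus); the L ≡ 2 mod 4 sides and every mechanism for
Continuation (inside the shared bet); any use of the chord at other fillings (the card documents
convexity for ρ ≲ 0.2 — not claimed).

CHEAPEST FALSIFIER. Exact diagonalisation of the S^z_tot = 0 sector on the next tori — 6×4 (dim
2.7·10⁶), √32×√32 and 8×4 (6·10⁸; ~2·10⁷ per momentum sector), 6×6 with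
translations — scanning Δ ∈ [-1.2, 1.2] in steps of 0.05 and printing (a) Λ_M(Δ) - (1+Δ)Λ_M(0) on
[-1,0], (b) Λ_M(Δ) - ((1+Δ)/2)(M²/2)(M²/2+1) on [-1,1], (c)
the second differences: one negative value in (a) or (b) kills the literal form of the corresponding
crux (certify the witness in interval arithmetic before
closing); SSE/worm QMC at M = 8–24 for (b) near Δ → 1⁻ (the thin-slack corner, 1-Δ ≈ π²/M²) as a
non-rigorous guide. Run so far: the card's pure-python
Lanczos on 4×4 and √20×√20 (all stencils concave on [-1.1,1.2] resp. [-1.0,1.1]; chord margins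
0.77/0.76 vs 0.10) and, this session, linear spin-wave theory
at M = ∞ (FM-end depletion slope 1/(4π) ≈ 0.080 < 1/8; XY point m² = 0.194 vs Tier-B demand 0.125;
Tier-A deficit uses 28% of its allowance near Δ = 0⁻) —
no violation found; kit was not available to the ideator and is not run by planners.

NUMBERS. m_xy(S=½ XY, d=2) = 0.437 ⇒ Λ/M⁴ → 0.191 at Δ = 0 (doi:10.1103/physrevb.60.6588); HAF m_s =
0.307 ⇒ Λ/M⁴ → 0.094 (Δ → -1⁺, full moment in plane) and
(2/3)·0.094 = 0.063 at Δ = -1 (doi:10.1103/physrevb.56.11678); FM endpoint Λ_M(1)/M⁴ = 1/4 + 1/(2M²)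
exactly. Chord demands at M = ∞: Tier A (1+Δ)·0.191,
Tier B (1+Δ)/8. LSW (this session): easy-plane FM depletion d(ε) ≈ ε/(4π) for H(1-ε), so Λ/M⁴ ≈ 1/4
- 0.064…0.080·ε vs chord 1/4 - ε/8. Card ED (Λ in
units of 1, M² = 16 | 20 sites): Δ = 1: 72 | 110 (exact); 0: 68.0 | 102.9; -0.5: 62.7 | 94.6; -0.9:
52.1 | 78.3; -1: 47.2 | 68.7; first positive second
difference at Δ = -1.15 (4×4) and ∈ (-1.2,-1.0) (√20), i.e. on the Ising side as the 2/3-share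
argument predicts. Plaquette lock-in (card
plaquette-pseudospin-lockin, uncertified ED): Δ_eff(U) = -0.986 (U=1), -0.993 (U=2), -1.003 (U=3),
-1.005 (U=4); pair binding Δ_pb = 0.018, 0.037,
0.039 (max, U≈2.5), 0 at U_c = 4.58; U_s ≈ 2.7. Proved easy-plane windows: |Δ| < 0.13
(KuboKishi1988), ≈ 0.20 (doi:10.1143/jpsj.58.1027,
doi:10.1051/jp1:1991109). Items at open: 12 (4 cruxes, 7 support, 1 assembly).

DEFINITION REQUESTS. None. Every constant exists and elaborates (Sketch.lean rc 0, 2026-08-15):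
Literature.MathematicalPhysics.QuantumLattice.{xxzHamiltonian, spinZSector,
lowestEnergyInSector, TensorIndex, onSite, spinRaise, spinLower, Fock, Orb, FermionTorus,
fermionTorusGraph, hamiltonian, hubbardTorus, IsGroundStateInSector,
expect, pairField, dWaveFormFactor, pairFieldCorr, torusPullback},
Literature.Probability.LatticeModels.{TorusSite, torusGraph, HasLongRangeOrder, halfOpenBox},
root HubbardSuperconductivity. Bib additions proposed with the route: Toth1991
(doi:10.1007/BF01329865), GriffithsHurstSherman1970 (doi:10.1063/1.1665211),
KunzPfisterVuillermot1976 (doi:10.1088/0305-4470/9/10/019), SandvikHamer1999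
(doi:10.1103/physrevb.60.6588), OkabeKikuchi1988 (doi:10.1143/jpsj.57.4351).

Novelty: Searches (2026-08-15, this session, on top of the card's audited list): `lit search --hybrid
"correlation inequalities anisotropic Heisenberg model
monotonicity in anisotropy"` (10 held books, none on point); `lit search "Kunz Pfister Vuillermot
inequalities classical spin vector models"` (local 10:
FriedliVelenik2017 p.606, arXiv:1611.06019, arXiv:1510.03215, arXiv:2205.12928 …; crossref 10:
doi:10.1016/0375-9601(75)90799-9,
doi:10.1088/0305-4470/9/10/019, doi:10.1016/0375-9601(76)90107-9 Bricmont, doi:10.1007/bf01107905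
Monroe–Pearce); `lit read arxiv:1611.06019` (BLU review,
Thm 1 / Cor 2: Ginibre inequalities for the S=½ quantum XY model with couplings in TWO spin
directions only — ⟨S¹⟩ monotone ↑ in J¹, ↓ in J²; nothing
joint with SᶻSᶻ, nothing second order); `lit frontier HubbardSuperconductivity --since 2020` (30
rows; arXiv:2410.00810 symmetry bootstrap = an SDP
certification engine for large-M tests, nothing on anisotropy transport); `lit bridges
HubbardSuperconductivity --cross any` (30 rows, none relevant);
crossref "Sandvik Hamer … XY model" → doi:10.1103/physrevb.60.6588; crossref "spin-1/2 XXZ square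
lattice QMC easy-plane order parameter" →
doi:10.1143/jpsj.57.4351, doi:10.1103/physrevb.52.10221 (numerics only); `ledger negatives` (0); all
42 Theses of the sub grepped for concav|chord|anisotrop
(hits are energy-concavity in g or U — DeformationLadder, doublon-maxwell — or the fixed-Δ crux
0906; no statement compares ground states at two
anisotropies). Refuter n  [refs: 10.1016/0375-9601(75, 10.1088/0305-4470/9/10/019, 10.1016/0375-9601(76, 10.1007/bf01107905, 10.1103/physrevb.60.6588, 10.1143/jpsj.57.4351, 10.1103/physrevb.52.10221, 10.1063/1.1665211, 10.1143/jpsj.58.1027, 10.1007/BF01329865, 1611.06019, 1510.03215, 2205.12928, 2410.00810, doi:10.1016/0375-9601, doi:10.1088/0305-4470/9/10/019, doi:10.1007/bf01107905, arxiv:1611.06019, doi:10.1103/physrevb.60.658]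

Barriers (technique_class: concavity-in-coupling chord-transport effective-boson): - technique_class: concavity-in-coupling chord-transport effective-boson
- Literature.Barriers.HubbardSuperconductivity.LROForcesLowLyingStates: evaded —
ChordXY/ChordFM/Concavity are finite-M inequalities between S^z_tot=0 sector ground-state
expectations of ⟨S⁺S⁻⟩-type (LRO, not an anomalous average) at different couplings; no gap, no
uniqueness beyond Perron–Frobenius of a stoquastic sector block, so the Koma–Tasaki tower (other
sectors, energies O(1/N)) is never touched; the fermionic items are every-GS pair-field LRO
statements exactly as the summit.
- Literature.Barriers.HubbardSuperconductivity.StrongCouplingCeiling: not met by the bosonic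
statements; met only where the plaquette programme already meets it — the second-order
Schrieffer–Wolff around gapped 2×2 plaquettes inside DressHalfFilled is a finite-order operator
identity in t'/Δ_pb (no t/U or cluster expansion of the SU(2) model is summed), and the t' ↑ 1
endpoint is the declared bet Continuation.
- Literature.Barriers.HubbardSuperconductivity.SignProblemNPHard: not met — stoquasticity of the XXZ
pair gas is used structurally (Perron–Frobenius, the Laplace-transform/variance identity behind
Concavity), never to sample fermions; ED/QMC appear only as falsifiers of the chords.
- Literature.Barriers.HubbardSuperconductivity.WeakCouplingCeiling: not in class — no expansion in
U; U₀ = O(1) sits in the plaquette pair-binding window and nothing is read off a series in U (the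
same holds for PerturbativeInvisibilityOfPai

Novelty grade: new-combination — ROUTE-REVIEW grade (refuter 2c4772d4, 2026-08-15): new-combination = [Griffiths 1967 order-transport architecture (order at one coupling + a correlation inequality ⇒ order on an interval, doi:10.1063/1.1705219) with a GHS-type SECOND-order (concavity) inequality (doi:10.1063/1.1665211) in the anisot (refuter refuter-rreview-route-HubbardSuperconduc-2c4772d4-0, 2026-08-15T13:52:10Z; prior: doi:10.1063/1.1705219, doi:10.1063/1.1665211, doi:10.1088/0305-4470/9/10/019, arXiv:1611.06019, KLS1988PRL, YaoTsaiKivelson2007, route-HubbardSuperconductivity-PlaquetteBoson)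

History (route lifecycle, newest last):
- 2026-08-24T08:52:42Z · DORMANT — reconciler: no traction for 6.6 d (last activity item-evidence-added at 2026-08-17T16:54:04Z); parked, not closed — `ledger route dormant route-HubbardSupercond (operator:999:1700532)
- 2026-08-26T04:24:51Z · REACTIVATED — reconciler: reactivated — activity item-evidence-added at 2026-08-25T19:28:31Z after parking at 2026-08-24T08:52:42Z (operator:999:2585632)

sub-problem: HubbardSuperconductivity · status: open · opened planner-plancard-HubbardSuperconductivity-Hub-98f84149-0 2026-08-15T12:31:43Z · rev 4 · ledger route-HubbardSuperconductivity-AnisotropyChord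
GENERATED by the gate from the ledger (D-0016/17). Provers cite these decls: `theorem foo : Summit.HubbardSuperconductivity.HubbardSuperconductivity.Theses.AnisotropyChord.<Decl> := …` in Summits/HubbardSuperconductivity/HubbardSuperconductivity/Theorems/<Name>.lean.
-/

namespace Summit.HubbardSuperconductivity.HubbardSuperconductivity.Theses.AnisotropyChord

open scoped BigOperators Topology Manifold Classical MeasureTheory ProbabilityTheory Matrix InnerProductSpace ComplexConjugate ContinuousMap
open Filter Set Function TopologicalSpace MeasureTheory

attribute [summit_statement] _root_.HubbardSuperconductivity

open Literature.Hubbard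

/-- item stmt-HubbardSuperconductivity-8146 · crux · rank 2 · open · by planner
why it might fail: Implies planar LRO at every Δ∈(-1,0] (open since 1988; RP closes only |Δ|≲0.2), so at least that hard; its d=1 analogue is FALSE (chain exponent η(Δ) rises ½→1 toward the AF point ⇒ Λ_N(Δ)/Λ_N(0)→0), so no dimension-blind correlation inequality gives it; all-even-M form untested beyond 20 sites.
sources: KLS1988PRL, KuboKishi1988, doi:10.1143/jpsj.58.1027, BenassiLeesUeltschi2016, arXiv:1611.06019, doi:10.1007/3-540-10238-8
[crux] TIER A CHORD (card K1, load-bearing weak form (CD) of concavity): for every even M ≥ 4, every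
Δ ∈ [-1,0], every normalised S^z_tot=0 sector ground state ψ₀ of H_M(0) (KLS point) and ψ of H_M(Δ):
(1+Δ)·Λ(ψ₀) ≤ Λ(ψ). Equality side conditions: Δ = 0 trivial (sector GS unique by Perron–Frobenius, H
stoquastic), Δ = -1 reads 0 ≤ ‖S⁻ψ‖². With SectorAnchorXY it gives Λ ≥ (1+Δ)c M⁴, i.e.
HalfFilledOrder with margin (1+Δ_eff)c ≈ 10⁻²c at the plaquette anisotropy. ED (card): all second
differences of Λ_M(Δ) negative on [-1.1,1.2] (4×4, step 0.05) and [-1.0,1.1] (√20×√20, step 0.1);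
chord margins Λ(-0.9)/Λ(0) = 0.767, 0.760 vs 0.1 needed. Intended engine: Concavity (support) via
the finite-β variance-comparison identity, then β→∞ at fixed M. [difficulty: open-problem] -/
@[route_item "route-HubbardSuperconductivity-AnisotropyChord", crux (bottleneck := idea) (experiment := "instrument: proved in Lean), and (d) a precise map of which proof ideas are dead and why. The live mathematical crux is a single inequality (the «log-s…") (source := "director Hubbard l.85 + director Hubbard l.81, 2026-09-01")]
def ChordXY : Prop :=
  ∀ (M : ℕ) [NeZero M], Even M → 4 ≤ M → ∀ Δ ∈ Set.Icc (-1:ℝ) 0, ∀ (ψ₀ ψ : Literature.MathematicalPhysics.QuantumLattice.TensorIndex (Literature.Probability.LatticeModels.TorusSite 2 M) 2 → ℂ), ψ₀ ∈ Literature.MathematicalPhysics.QuantumLattice.spinZSector (Λ := Literature.Probability.LatticeModels.TorusSite 2 M) 1 0 → star ψ₀ ⬝ᵥ ψ₀ = 1 → Matrix.mulVec (Literature.MathematicalPhysics.QuantumLattice.xxzHamiltonian 1 (Literature.Probability.LatticeModels.torusGraph 2 M) (-1) 0) ψ₀ = ((Literature.MathematicalPhysics.QuantumLattice.lowestEnergyInSector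 1 (Literature.MathematicalPhysics.QuantumLattice.xxzHamiltonian 1 (Literature.Probability.LatticeModels.torusGraph 2 M) (-1) 0) 0 : ℝ) : ℂ) • ψ₀ → ψ ∈ Literature.MathematicalPhysics.QuantumLattice.spinZSector (Λ := Literature.Probability.LatticeModels.TorusSite 2 M) 1 0 → star ψ ⬝ᵥ ψ = 1 → Matrix.mulVec (Literature.MathematicalPhysics.QuantumLattice.xxzHamiltonian 1 (Literature.Probability.LatticeModels.torusGraph 2 M) (-1) Δ) ψ = ((Literature.MathematicalPhysics.QuantumLattice.lowestEnergyInSector 1 (Literature.MathematicalPhysics.QuantumLattice.xxzHamiltonian 1 (Literature.Probability.LatticeModels.torusGraph 2 M) (-1) Δ) 0 : ℝ) : ℂ) • ψ → (1 + Δ) * (star ψ₀ ⬝ᵥ Matrix.mulVec ((∑ x : Literature.Probability.LatticeModels.TorusSite 2 M, Literature.MathematicalPhysics.QuantumLattice.onSite x (Literature.MathematicalPhysics.QuantumLattice.spinRaise 1)) * (∑ y : Literature.Probability.LatticeModels.TorusSite 2 M, Literature.MathematicalPhysics.QuantumLattice.onSite y (Literature.MathematicalPhysics.QuantumLattice.spinLower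 1))) ψ₀).re ≤ (star ψ ⬝ᵥ Matrix.mulVec ((∑ x : Literature.Probability.LatticeModels.TorusSite 2 M, Literature.MathematicalPhysics.QuantumLattice.onSite x (Literature.MathematicalPhysics.QuantumLattice.spinRaise 1)) * (∑ y : Literature.Probability.LatticeModels.TorusSite 2 M, Literature.MathematicalPhysics.QuantumLattice.onSite y (Literature.MathematicalPhysics.QuantumLattice.spinLower 1))) ψ).re

/-- item stmt-HubbardSuperconductivity-8147 · crux · rank 3 · open · by planner
why it might fail: M=∞ form: m²_xy(Δ) ≥ (1+Δ)/8 on (-1,1) — 65% of QMC 0.191 at Δ=0; at the FM end depletion slope ≤ 1/8 vs LSW 1/(4π)=0.080, 36% slack with O(1) 1/S corrections for S=½ uncontrolled; no rigorous bound on a quantum magnet is that sharp; false in d=1; ED ≤20 sites cannot probe 1-Δ ≲ π²/M².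
sources: Toth1991, Toth1990, Penrose1991, Tasaki2020, SandvikHamer1999, doi:10.1103/physrevb.44.11869
[crux] TIER B CHORD, reflection-positivity-FREE (card K2): for every even M ≥ 4, every Δ ∈ [-1,1]
and every normalised S^z_tot=0 sector ground state ψ of H_M(Δ): ((1+Δ)/2)·(M²/2)(M²/2+1) ≤ Λ(ψ) —
the chord from the exact ferromagnetic value Λ_M(1) = (M²/2)(M²/2+1) (FerroPointValue; Tóth's
universal maximum of ⟨B†B⟩ on the sector) to 0 at the AF point. Alone it gives HalfFilledOrder with
the explicit constant c(Δ) = (1+Δ)/8 (ChordToOrderFM) — planar LRO of the S=½ XXZ ground state for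
every Δ ∈ (-1,1) and m²_xy ≥ 1/8 at the XY point WITHOUT reflection positivity; it can replace
ChordXY ∧ SectorAnchorXY in the Assembly (one restate). ED (card): Λ/M⁴·… 4×4: Λ(1)=72 (exact),
Λ(0)=68.0 ≥ 36, Λ(-0.9)=52.1 ≥ 3.6; √20: 110 (exact), 102.9 ≥ 55, 78.3 ≥ 5.5. M=∞ check (LSW, this
session): slope at the FM end 0.064–0.080 < 0.125. [difficulty: open-problem] -/
@[route_item "route-HubbardSuperconductivity-AnisotropyChord", crux]
def ChordFM : Prop :=
  ∀ (M : ℕ) [NeZero M], Even M → 4 ≤ M → ∀ Δ ∈ Set.Icc (-1:ℝ) 1, ∀ (ψ : Literature.MathematicalPhysics.QuantumLattice.TensorIndex (Literature.Probability.LatticeModels.TorusSite 2 M) 2 → ℂ), ψ ∈ Literature.MathematicalPhysics.QuantumLattice.spinZSector (Λ := Literature.Probability.LatticeModels.TorusSite 2 M) 1 0 → star ψ ⬝ᵥ ψ = 1 → Matrix.mulVec (Literature.MathematicalPhysics.QuantumLattice.xxzHamiltonian 1 (Literature.Probability.LatticeModels.torusGraph 2 M) (-1) Δ) ψ = ((Literature.MathematicalPhysics.QuantumLattice.lowestEnergyInSector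 1 (Literature.MathematicalPhysics.QuantumLattice.xxzHamiltonian 1 (Literature.Probability.LatticeModels.torusGraph 2 M) (-1) Δ) 0 : ℝ) : ℂ) • ψ → (1 + Δ) / 2 * ((M : ℝ) ^ 2 / 2 * ((M : ℝ) ^ 2 / 2 + 1)) ≤ (star ψ ⬝ᵥ Matrix.mulVec ((∑ x : Literature.Probability.LatticeModels.TorusSite 2 M, Literature.MathematicalPhysics.QuantumLattice.onSite x (Literature.MathematicalPhysics.QuantumLattice.spinRaise 1)) * (∑ y : Literature.Probability.LatticeModels.TorusSite 2 M, Literature.MathematicalPhysics.QuantumLattice.onSite y (Literature.MathematicalPhysics.QuantumLattice.spinLower 1))) ψ).re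

/-- item stmt-HubbardSuperconductivity-8148 · crux · rank 4 · open · by planner
why it might fail: Needs a U with CERTIFIED Δ_eff(U)=-V/2J∈(-1,0]: YTK give V/J<2 only for U<U_s≈2.7, card ED -0.986…-0.993, 1% from the 1st-order d-CDW point; then gapless U(1) LRO of H_XXZ(Δ_eff) must survive the O(t')-relative Schrieffer–Wolff remainder uniformly in L — stability is known for gapped phases only.
sources: YaoTsaiKivelson2007, TsaiKivelson2006, doi:10.1103/physrevb.65.104508, BravyiHastingsMichalakis2010, AizenmanEtAl2004, KLS1988PRL
[crux] DRESSING LEMMA at boson half filling, implication form (the fermionic half of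
PlaquetteBoson's PbAnchorOrder with its bosonic input made an explicit hypothesis): HalfFilledOrder
(planar order ≥ c(Δ)M⁴ of every half-filled sector GS of H_M(Δ), eventually in even M, for EVERY Δ ∈
(-1,0]) → AnchorOrder (∃ U > 0, δ ∈ (0,1/2), t₀ > 0: for t' ∈ (0,t₀), eventually in L ∈ 4ℕ, every
normalised (N_L,0)-sector GS of the checkerboard torus hamiltonian(G_intra,1,U) +
hamiltonian(G_inter,t',0), N_L = 2⌊(1-δ)L²/2⌋, has Re⟨Δ_d†Δ_d⟩ ≥ c(t')L⁴). Intended proof: pick U₀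
in the pair-binding window with certified Δ_eff(U₀) = -v(U₀)/2j(U₀) ∈ (-1,0] (ED: U₀ ∈ [1,2]) and δ
= 1/4 (hole pairs = half-filled hard-core bosons on the (L/2)-torus, no monotone depletion needed);
second-order Schrieffer–Wolff H_L(t',U₀) = t'²j·H_{L/2}(Δ_eff) ⊕ high + O(t'³); instantiate the
hypothesis at Δ_eff; show the order survives the U(1)-symmetric non-RP remainder and projects onto
Δ_d with O(1) overlap (B1g pair wavefunction of the plaquette). [difficulty: XL] -/
@[route_item "route-HubbardSuperconductivity-AnisotropyChord", crux]
def DressHalfFilled : Prop :=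
  (∀ Δ ∈ Set.Ioc (-1:ℝ) 0, ∃ c : ℝ, 0 < c ∧ ∃ M₀ : ℕ, ∀ (M : ℕ) [NeZero M], Even M → M₀ ≤ M → ∀ (ψ : Literature.MathematicalPhysics.QuantumLattice.TensorIndex (Literature.Probability.LatticeModels.TorusSite 2 M) 2 → ℂ), ψ ∈ Literature.MathematicalPhysics.QuantumLattice.spinZSector (Λ := Literature.Probability.LatticeModels.TorusSite 2 M) 1 0 → star ψ ⬝ᵥ ψ = 1 → Matrix.mulVec (Literature.MathematicalPhysics.QuantumLattice.xxzHamiltonian 1 (Literature.Probability.LatticeModels.torusGraph 2 M) (-1) Δ) ψ = ((Literature.MathematicalPhysics.QuantumLattice.lowestEnergyInSector 1 (Literature.MathematicalPhysics.QuantumLattice.xxzHamiltonian 1 (Literature.Probability.LatticeModels.torusGraph 2 M) (-1) Δ) 0 : ℝ) : ℂ) • ψ → c * (M : ℝ) ^ 4 ≤ (star ψ ⬝ᵥ Matrix.mulVec ((∑ x : Literature.Probability.LatticeModels.TorusSite 2 M, Literature.MathematicalPhysics.QuantumLattice.onSite x (Literature.MathematicalPhysics.QuantumLattice.spinRaise 1))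 * (∑ y : Literature.Probability.LatticeModels.TorusSite 2 M, Literature.MathematicalPhysics.QuantumLattice.onSite y (Literature.MathematicalPhysics.QuantumLattice.spinLower 1))) ψ).re) → (∃ U : ℝ, 0 < U ∧ ∃ δ ∈ Set.Ioo (0:ℝ) (1/2), ∃ t₀ : ℝ, 0 < t₀ ∧ ∀ t' ∈ Set.Ioo (0:ℝ) t₀, ∃ c : ℝ, 0 < c ∧ ∃ L₀ : ℕ, ∀ (L : ℕ) [NeZero L], L₀ ≤ L → 4 ∣ L → ∀ (N : ℕ) (ψ : Literature.MathematicalPhysics.QuantumLattice.Fock (Literature.MathematicalPhysics.QuantumLattice.Orb (Literature.MathematicalPhysics.QuantumLattice.FermionTorus 2 L))), N = 2 * ⌊(1 - δ) * (L : ℝ) ^ 2 / 2⌋₊ → star ψ ⬝ᵥ ψ = 1 → Literature.MathematicalPhysics.QuantumLattice.IsGroundStateInSector (Literature.MathematicalPhysics.QuantumLattice.hamiltonian ((Literature.MathematicalPhysics.QuantumLattice.fermionTorusGraph 2 L) \ SimpleGraph.comap (fun x : Literature.MathematicalPhysics.QuantumLattice.FermionTorus 2 L => fun i : Fin 2 =>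 ((ofLex x) i : ℕ) / 2) ⊤) 1 U + Literature.MathematicalPhysics.QuantumLattice.hamiltonian ((Literature.MathematicalPhysics.QuantumLattice.fermionTorusGraph 2 L) ⊓ SimpleGraph.comap (fun x : Literature.MathematicalPhysics.QuantumLattice.FermionTorus 2 L => fun i : Fin 2 => ((ofLex x) i : ℕ) / 2) ⊤) t' 0) N 0 ψ → c * (L : ℝ) ^ 4 ≤ (Literature.MathematicalPhysics.QuantumLattice.expect ((Literature.MathematicalPhysics.QuantumLattice.pairField Literature.MathematicalPhysics.QuantumLattice.dWaveFormFactor L)ᴴ * Literature.MathematicalPhysics.QuantumLattice.pairField Literature.MathematicalPhysics.QuantumLattice.dWaveFormFactor L) ψ).re)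

/-- item stmt-HubbardSuperconductivity-0907 · crux · rank 5 · open · by planner
why it might fail: ∀(U,δ) implication, no tool (no continuity of GS order in t'∈(0,1]); expected FALSE where small-t' pair order exists but the uniform GS is not d_{x²-y²}: U≤4, δ>0.4 (d_xy/p, DengEtAl2015), δ→0⁺ (AF), U≈6–8, δ≈1/8 (stripes, QinEtAl2020); 1st-order d-CDW/PS on the t' path near U_s≈2.7 (YTK p.4).
sources: DengEtAl2015, QinEtAl2020, DoluweeraEtAl2008, YaoTsaiKivelson2007, ChakrabortySenechalTremblay2011, doi:10.1103/physrevb.83.054508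
[crux] CONTINUATION t' → 1 (the bet A4 of plaquette-boson-kls-anchor, typed as an implication so
that the Assembly is pure logic): for all U > 0, δ ∈ (0,1/2): [anchor-type every-GS d-wave order
⟨Δ_d†Δ_d⟩ ≥ c(t')L⁴ on L ∈ 4ℕ tori for all t' ∈ (0,t₀)] ⇒ [the summit's conclusion at (U,δ): every
HYP-admissible ground-state sequence of hubbardTorus 2 L 1 U (= H_L(1,U)) has HasLongRangeOrder of
torusPullback (pairFieldCorr dWaveFormFactor ψ) along even sides]. Content: no quantum phase
transition in t' at fixed (U,δ), plus removal of the L ≡ 0 mod 4 artefact at the uniform point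
(where no plaquette structure remains) and the pointwise-to-liminf bookkeeping (expect(Δ_d†Δ_d) =
Σ_{x,y} pairFieldCorr, `expect_pairField_conjTranspose_mul`). Tool-less today like every
continuation; handles: δ is free (pick it away from 1/8-type commensurabilities and inside the DCA
dome), Rellich/Kato continuation of the B1g pair susceptibility protected by a twist-gap lower bound
(card twist-gap-protects-condensate), and numerics FIRST (t'-scan of the d-wave order by
DCA/CDMFT/DMRG at the chosen (U,δ)). A refutation here closes the route but leaves
PbAnchorOrder/PbMonotoneDepletion/PbHalfFilledXYOrder as Lite -/
@[route_item "route-HubbardSuperconductivity-AnisotropyChord", crux]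
def Continuation : Prop :=
  ∀ (U δ : ℝ), 0 < U → δ ∈ Set.Ioo (0:ℝ) (1/2) → (∃ t₀ : ℝ, 0 < t₀ ∧ ∀ t' ∈ Set.Ioo (0:ℝ) t₀, ∃ c : ℝ, 0 < c ∧ ∃ L₀ : ℕ, ∀ (L : ℕ) [NeZero L], L₀ ≤ L → 4 ∣ L → ∀ (N : ℕ) (ψ : Literature.MathematicalPhysics.QuantumLattice.Fock (Literature.MathematicalPhysics.QuantumLattice.Orb (Literature.MathematicalPhysics.QuantumLattice.FermionTorus 2 L))), N = 2 * ⌊(1 - δ) * (L : ℝ) ^ 2 / 2⌋₊ → star ψ ⬝ᵥ ψ = 1 → Literature.MathematicalPhysics.QuantumLattice.IsGroundStateInSector (Literature.MathematicalPhysics.QuantumLattice.hamiltonian ((Literature.MathematicalPhysics.QuantumLattice.fermionTorusGraph 2 L) \ SimpleGraph.comap (fun x : Literature.MathematicalPhysics.QuantumLattice.FermionTorus 2 L => fun i : Fin 2 => ((ofLex x) i : ℕ) / 2) ⊤) 1 U + Literature.MathematicalPhysics.QuantumLattice.hamiltonian ((Literature.MathematicalPhysics.QuantumLattice.fermionTorusGraph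 2 L) ⊓ SimpleGraph.comap (fun x : Literature.MathematicalPhysics.QuantumLattice.FermionTorus 2 L => fun i : Fin 2 => ((ofLex x) i : ℕ) / 2) ⊤) t' 0) N 0 ψ → c * (L : ℝ) ^ 4 ≤ (Literature.MathematicalPhysics.QuantumLattice.expect ((Literature.MathematicalPhysics.QuantumLattice.pairField Literature.MathematicalPhysics.QuantumLattice.dWaveFormFactor L)ᴴ * Literature.MathematicalPhysics.QuantumLattice.pairField Literature.MathematicalPhysics.QuantumLattice.dWaveFormFactor L) ψ).re) → ∀ (N : ℕ → ℕ) (ψ : ∀ L, Literature.MathematicalPhysics.QuantumLattice.Fock (Literature.MathematicalPhysics.QuantumLattice.Orb (Literature.MathematicalPhysics.QuantumLattice.FermionTorus 2 L))), (∀ L, Even L → N L = 2 * ⌊(1 - δ) * (L : ℝ) ^ 2 / 2⌋₊ ∧ star (ψ L) ⬝ᵥ ψ L = 1 ∧ Literature.MathematicalPhysics.QuantumLattice.IsGroundStateInSector (Literature.MathematicalPhysics.QuantumLattice.hubbardTorus 2 L 1 U) (N L) 0 (ψ L)) → Literature.Probability.LatticeModels.HasLongRangeOrder (fun k => Literature.Probability.LatticeModels.halfOpenBox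 2 (2 * k)) (fun k => Literature.MathematicalPhysics.QuantumLattice.torusPullback (Literature.MathematicalPhysics.QuantumLattice.pairFieldCorr Literature.MathematicalPhysics.QuantumLattice.dWaveFormFactor ψ) (2 * k))

/-- item stmt-HubbardSuperconductivity-19089 · crux · rank 6 · SPLIT (gen 1) into FerroSideChordLarge, FerroSideChordSmall, FerroSideChordEndpoints + glue FerroSideChordOfPieces · direct attempts still welcome (low priority) · by planner
why it might fail: M=∞ form m²_xy(Δ) ≥ (1+Δ)/8 on [0,1): FM-end depletion slope must be ≤ 1/8 vs LSW 1/(4π)=0.080 (36% slack) with uncontrolled 1/S corrections for S=½; 35% slack at Δ=0 vs QMC; no RP-free (or RP) LRO bound for a d=2 quantum easy-plane ferromagnet is anywhere near this sharp; only M=4 checked exactly.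
sources: doi:10.1007/BF01329865, Tasaki2020, doi:10.1103/physrevb.60.6588, KLS1988PRL, BenassiLeesUeltschi2016, arXiv:1611.06019
[crux] FM-SIDE CHORD — piece 2 of the typed decomposition ChordFM ⇐ ChordXY ∧ FerroSideChord
(crux-strategist 2026-08-17): for every even M ≥ 4, every Δ ∈ [0,1] (the FERROMAGNETIC regime:
planar exchange 1 and Ising exchange Δ both ferromagnetic) and every normalised S^z_tot=0 sector
ground state ψ of H_M(Δ) = xxzHamiltonian 1 (torusGraph 2 M) (-1) Δ: ((1+Δ)/2)·(M²/2)(M²/2+1) ≤ Λ(ψ)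
= Re⟨ψ, S⁺_tot S⁻_tot ψ⟩ — the Tier-B chord from the exact ferromagnetic value S(S+1), S = M²/2
(FerroPointValue, PROVED) restricted to the ferromagnetic side. Its Δ = 0 endpoint is the
reflection-positivity-FREE anchor at the KLS point, Λ_M(0) ≥ S(S+1)/2 (planar order m²_xy ≥ 1/8 of
the S=½ quantum XY model = half-filled hard-core Bose gas, at every even M ≥ 4), which ChordXY
transports to Δ < 0; for Δ ≥ 0 it is ChordFM verbatim. Assembly ChordXY → FerroSideChord → ChordFM
PROVED sorry-free (theorem chordFM_of_chordXY_ferroSideChord, evidence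
AnisotropyChordChordFMSplit.lean on stmt-8147: case split at the KLS point + existence of a
normalised sector GS of H_M(0) via exists_unit_sectorGroundState_xy + chained inequalities). Physics
of this piece: easy-plane S=½ FERROMAGNET (no competing coupling); at f -/
@[route_item "route-HubbardSuperconductivity-AnisotropyChord"]
def FerroSideChord : Prop :=
  ∀ (M : ℕ) [NeZero M], Even M → 4 ≤ M → ∀ Δ ∈ Set.Icc (0:ℝ) 1, ∀ (ψ : Literature.MathematicalPhysics.QuantumLattice.TensorIndex (Literature.Probability.LatticeModels.TorusSite 2 M) 2 → ℂ), ψ ∈ Literature.MathematicalPhysics.QuantumLattice.spinZSector (Λ := Literature.Probability.LatticeModels.TorusSite 2 M) 1 0 → star ψ ⬝ᵥ ψ = 1 → Matrix.mulVec (Literature.MathematicalPhysics.QuantumLattice.xxzHamiltonian 1 (Literature.Probability.LatticeModels.torusGraph 2 M) (-1) Δ) ψ = ((Literature.MathematicalPhysics.QuantumLattice.lowestEnergyInSector 1 (Literature.MathematicalPhysics.QuantumLattice.xxzHamiltonian 1 (Literature.Probability.LatticeModels.torusGraph 2 M) (-1) Δ) 0 : ℝ) : ℂ) • ψ → (1 +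 Δ) / 2 * ((M : ℝ) ^ 2 / 2 * ((M : ℝ) ^ 2 / 2 + 1)) ≤ (star ψ ⬝ᵥ Matrix.mulVec ((∑ x : Literature.Probability.LatticeModels.TorusSite 2 M, Literature.MathematicalPhysics.QuantumLattice.onSite x (Literature.MathematicalPhysics.QuantumLattice.spinRaise 1)) * (∑ y : Literature.Probability.LatticeModels.TorusSite 2 M, Literature.MathematicalPhysics.QuantumLattice.onSite y (Literature.MathematicalPhysics.QuantumLattice.spinLower 1))) ψ).re

-- parent: FerroSideChord · child (gen 1)
/--     item stmt-HubbardSuperconductivity-23918 · crux · rank 601 · open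
    parent: FerroSideChord · by planner
    why it might fail: Positive magnon density: m²_xy(Δ) ≥ (1+Δ)/8 ∀ large even M is an RP-free T=0 LRO bound for the 2D S=½ planar ferromagnet (RP fails, Speer 1985); GM_n is proved only for n ≤ 3 magnons; LSW depletion slope 1/(4π) vs allowed 1/8 leaves 36% for 1/S corrections.
    sources: Speer1985, KLS1988PRL, Tasaki2020, doi:10.1007/BF01329865, doi:10.1103/physrevb.60.6588, BenassiLeesUeltschi2016
[crux · piece A of the range split of FerroSideChord (tenure D1, director-hubbard 2026-08-30;
BONDBS-KTPLAN-g26 §2/§4)] the FM-side chord on the GM₃ chain's reachable range: for every EVEN M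
with 9 ≤ M (i.e. M ≥ 10), every Δ ∈ (0,1) and every normalised S^z_tot = 0 sector ground state ψ of
H_M(Δ) = xxzHamiltonian 1 (torusGraph 2 M) (-1) Δ: ((1+Δ)/2)·(M²/2)(M²/2+1) ≤ Re⟨ψ, S⁺_tot S⁻_tot
ψ⟩. TAG (D-0171): WEAKER than FerroSideChord only formally (drops M ∈ {4,6,8} and the endpoints Δ ∈
{0,1}); it carries the whole thermodynamic content m²_xy(Δ) ≥ (1+Δ)/8 of the parent — UNDECIDED,
leaf IDEA-NEEDED: the cell's vehicle is CONJECTURE GM / MON-n (gap monotonicity in magnon number),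
whose rungs n = 2 (GM₂, PROVED ∀ L ≥ 3) and n = 3 (GM₃: gm3_of_hole2 p742041, gm3_finRange p751914,
Hole2.twoHoleGap_finRange p751341, Fibre3ChannelLarge p754295 (39 ≤ L), DyadicRateSharp p751250,
DiagonalRateLemmas p751674, TwoHoleBSNearSharp p751517, Hole2L33a p752105, LEMMA V′ PartN36,
HOLE₂(3/4·ε₁) ∀ L ≥ 9 chain II–VI) attach HERE as helpers; the positive-density step n ~ M²/2 has no
vehicle yet (theory-1 HANDOFF Add.32–36, ROTOR-S-BRIDGE-VERDICT.md), and reflection positivity is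
unavailable for the planar -/
@[route_item "route-HubbardSuperconductivity-AnisotropyChord", crux]
def FerroSideChordLarge : Prop :=
  ∀ (M : ℕ) [NeZero M], Even M → 9 ≤ M → ∀ Δ ∈ Set.Ioo (0:ℝ) 1, ∀ (ψ : Literature.MathematicalPhysics.QuantumLattice.TensorIndex (Literature.Probability.LatticeModels.TorusSite 2 M) 2 → ℂ), ψ ∈ Literature.MathematicalPhysics.QuantumLattice.spinZSector (Λ := Literature.Probability.LatticeModels.TorusSite 2 M) 1 0 → star ψ ⬝ᵥ ψ = 1 → Matrix.mulVec (Literature.MathematicalPhysics.QuantumLattice.xxzHamiltonian 1 (Literature.Probability.LatticeModels.torusGraph 2 M) (-1) Δ) ψ = ((Literature.MathematicalPhysics.QuantumLattice.lowestEnergyInSector 1 (Literature.MathematicalPhysics.QuantumLattice.xxzHamiltonian 1 (Literature.Probability.LatticeModels.torusGraph 2 M) (-1) Δ) 0 : ℝ) : ℂ) • ψ → (1 + Δ) / 2 * ((M : ℝ) ^ 2 / 2 * ((M : ℝ) ^ 2 / 2 + 1)) ≤ (star ψ ⬝ᵥ Matrix.mulVec ((∑ x : Literature.Probability.LatticeModels.TorusSite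 2 M, Literature.MathematicalPhysics.QuantumLattice.onSite x (Literature.MathematicalPhysics.QuantumLattice.spinRaise 1)) * (∑ y : Literature.Probability.LatticeModels.TorusSite 2 M, Literature.MathematicalPhysics.QuantumLattice.onSite y (Literature.MathematicalPhysics.QuantumLattice.spinLower 1))) ψ).re

-- parent: FerroSideChord · child (gen 1)
/--     item stmt-HubbardSuperconductivity-23919 · support · rank 602 · open
    parent: FerroSideChord · by planner
    sources: Summit.HubbardSuperconductivity.HubbardSuperconductivity.Theorems.AnisotropyChord.FourTorus.ferroSideChord_four, doi:10.1103/physrevb.60.6588, Tasaki2020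
[support · residual B of the range split of FerroSideChord (tenure D1)] the small tori: for every
EVEN M with 4 ≤ M ≤ 8 (M ∈ {4,6,8}), every Δ ∈ (0,1) and every normalised S^z_tot = 0 sector ground
state ψ of H_M(Δ): ((1+Δ)/2)·(M²/2)(M²/2+1) ≤ Re⟨ψ, S⁺_tot S⁻_tot ψ⟩. TAG (D-0171): residual, per
case — M = 4 PROVED (tree theorem Theorems.AnisotropyChord.FourTorus.ferroSideChord_four, p694575,
states it on [0,1] ⊇ (0,1); planner Sanity.lean instantiates it); M = 6 UNDECIDED / INSTRUMENTABLE
(S^z=0 sector dim C(36,18) ≈ 9.1e9, ≈ 1.6e7 per translation × C₄ᵥ × spin-flip block: Lanczos or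
SSE-QMC numerics decide it cheaply, a kernel certificate in the FourTorus style is out of reach — p1
g18); M = 8 UNDECIDED (dim C(64,32) ≈ 1.8e18, no finite certificate; HOLE₂ is FALSE at L = 8
(not_twoHoleGap_eight) so even the GM₃ rung is open there; expected to fall only with piece A's
method). Nothing here proves superconductivity in the Hubbard model. -/
@[route_item "route-HubbardSuperconductivity-AnisotropyChord", crux]
def FerroSideChordSmall : Prop :=
  ∀ (M : ℕ) [NeZero M], Even M → 4 ≤ M → M ≤ 8 → ∀ Δ ∈ Set.Ioo (0:ℝ) 1, ∀ (ψ : Literature.MathematicalPhysics.QuantumLattice.TensorIndex (Literature.Probability.LatticeModels.TorusSite 2 M) 2 → ℂ), ψ ∈ Literature.MathematicalPhysics.QuantumLattice.spinZSector (Λ := Literature.Probability.LatticeModels.TorusSite 2 M) 1 0 → star ψ ⬝ᵥ ψ = 1 → Matrix.mulVec (Literature.MathematicalPhysics.QuantumLattice.xxzHamiltonian 1 (Literature.Probability.LatticeModels.torusGraph 2 M) (-1) Δ) ψ = ((Literature.MathematicalPhysics.QuantumLattice.lowestEnergyInSector 1 (Literature.MathematicalPhysics.QuantumLattice.xxzHamiltonian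 1 (Literature.Probability.LatticeModels.torusGraph 2 M) (-1) Δ) 0 : ℝ) : ℂ) • ψ → (1 + Δ) / 2 * ((M : ℝ) ^ 2 / 2 * ((M : ℝ) ^ 2 / 2 + 1)) ≤ (star ψ ⬝ᵥ Matrix.mulVec ((∑ x : Literature.Probability.LatticeModels.TorusSite 2 M, Literature.MathematicalPhysics.QuantumLattice.onSite x (Literature.MathematicalPhysics.QuantumLattice.spinRaise 1)) * (∑ y : Literature.Probability.LatticeModels.TorusSite 2 M, Literature.MathematicalPhysics.QuantumLattice.onSite y (Literature.MathematicalPhysics.QuantumLattice.spinLower 1))) ψ).re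

-- parent: FerroSideChord · child (gen 1)
/--     item stmt-HubbardSuperconductivity-23920 · support · rank 603 · open
    parent: FerroSideChord · by planner
    sources: Summit.HubbardSuperconductivity.HubbardSuperconductivity.Theorems.AnisotropyChord.ferroPointValue_proof, Tasaki2020, LiebMattis1962
[support · residual C of the range split of FerroSideChord (tenure D1)] the endpoints from the
interior: for every EVEN M ≥ 4, IF the chord bound holds for every Δ ∈ (0,1) (and every normalised
S^z_tot=0 sector GS of H_M(Δ)) THEN it holds at Δ = 0 and at Δ = 1. TAG (D-0171): ATTACKABLE /
provable-now. Δ = 1: FerroPointValue (PROVED, ferroPointValue_proof) gives equality Λ =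
(M²/2)(M²/2+1) = chord(1). Δ = 0: finite-dimensional continuity — for every real Δ the S^z=0 sector
ground state of the stoquastic, sector-connected H_M(Δ) is the unique Perron vector a(Δ) (tree:
Transfer.exists_perron_zero_of_even, Stiffness.sectorGround_eq_smul_perron) and Λ(ψ) = lowerNormSq
a(Δ) for every normalised sector GS ψ (Stiffness.lambda_eq_lowerNormSq_of_sectorGround); Δ_n ↓ 0 ⇒
a(Δ_n) has limit points on the compact unit sphere, each a non-negative unit eigenvector of H_M(0)
at energy lim E₀(Δ_n) = E₀(0) (E₀ = lowestEnergyInSector is 1-Lipschitz in Δ up to ‖Σ SᶻSᶻ‖), hence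
= a(0); so Λ_M(Δ_n) → Λ_M(0) and chord(Δ_n) → chord(0) = S(S+1)/2, and ≤ is closed. ~150–300 Lean
lines (Bolzano–Weierstrass in a Pi type over a Fintype, tendsto_subseq_of_bounded /
IsCompact.tendsto_subseq). Nothing here proves s -/
@[route_item "route-HubbardSuperconductivity-AnisotropyChord"]
def FerroSideChordEndpoints : Prop :=
  ∀ (M : ℕ) [NeZero M], Even M → 4 ≤ M → (∀ Δ ∈ Set.Ioo (0:ℝ) 1, ∀ (ψ : Literature.MathematicalPhysics.QuantumLattice.TensorIndex (Literature.Probability.LatticeModels.TorusSite 2 M) 2 → ℂ), ψ ∈ Literature.MathematicalPhysics.QuantumLattice.spinZSector (Λ := Literature.Probability.LatticeModels.TorusSite 2 M) 1 0 → star ψ ⬝ᵥ ψ = 1 → Matrix.mulVec (Literature.MathematicalPhysics.QuantumLattice.xxzHamiltonian 1 (Literature.Probability.LatticeModels.torusGraph 2 M) (-1) Δ) ψ = ((Literature.MathematicalPhysics.QuantumLattice.lowestEnergyInSector 1 (Literature.MathematicalPhysics.QuantumLattice.xxzHamiltonian 1 (Literature.Probability.LatticeModels.torusGraph 2 M) (-1)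 Δ) 0 : ℝ) : ℂ) • ψ → (1 + Δ) / 2 * ((M : ℝ) ^ 2 / 2 * ((M : ℝ) ^ 2 / 2 + 1)) ≤ (star ψ ⬝ᵥ Matrix.mulVec ((∑ x : Literature.Probability.LatticeModels.TorusSite 2 M, Literature.MathematicalPhysics.QuantumLattice.onSite x (Literature.MathematicalPhysics.QuantumLattice.spinRaise 1)) * (∑ y : Literature.Probability.LatticeModels.TorusSite 2 M, Literature.MathematicalPhysics.QuantumLattice.onSite y (Literature.MathematicalPhysics.QuantumLattice.spinLower 1))) ψ).re) → ∀ Δ : ℝ, (Δ = 0 ∨ Δ = 1) → ∀ (ψ : Literature.MathematicalPhysics.QuantumLattice.TensorIndex (Literature.Probability.LatticeModels.TorusSite 2 M) 2 → ℂ), ψ ∈ Literature.MathematicalPhysics.QuantumLattice.spinZSector (Λ := Literature.Probability.LatticeModels.TorusSite 2 M) 1 0 → star ψ ⬝ᵥ ψ = 1 → Matrix.mulVec (Literature.MathematicalPhysics.QuantumLattice.xxzHamiltonian 1 (Literature.Probability.LatticeModels.torusGraph 2 M) (-1) Δ) ψ = ((Literature.MathematicalPhysics.QuantumLattice.lowestEnergyInSector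 1 (Literature.MathematicalPhysics.QuantumLattice.xxzHamiltonian 1 (Literature.Probability.LatticeModels.torusGraph 2 M) (-1) Δ) 0 : ℝ) : ℂ) • ψ → (1 + Δ) / 2 * ((M : ℝ) ^ 2 / 2 * ((M : ℝ) ^ 2 / 2 + 1)) ≤ (star ψ ⬝ᵥ Matrix.mulVec ((∑ x : Literature.Probability.LatticeModels.TorusSite 2 M, Literature.MathematicalPhysics.QuantumLattice.onSite x (Literature.MathematicalPhysics.QuantumLattice.spinRaise 1)) * (∑ y : Literature.Probability.LatticeModels.TorusSite 2 M, Literature.MathematicalPhysics.QuantumLattice.onSite y (Literature.MathematicalPhysics.QuantumLattice.spinLower 1))) ψ).re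

-- parent: FerroSideChord · glue (gen 1)
/--     item stmt-HubbardSuperconductivity-23921 · support · rank 604 · open
    parent: FerroSideChord · GLUE: children ⟹ parent · by planner
FerroSideChordLarge → FerroSideChordSmall → FerroSideChordEndpoints → FerroSideChord: pure logic —
case split M ≤ 8 (piece B) / 9 ≤ M (piece A) on the open interval Δ ∈ (0,1), and Δ ∈ {0,1} handed to
piece C applied to that interior statement. PROVED sorry-free by the tenure planner (Sketch.lean
`ferroSideChord_of_pieces`, lean check rc 0, axioms propext/Classical.choice/Quot.sound; attached as
evidence) — a prover lands it verbatim as `theorem … : FerroSideChordOfPieces`. Range split per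
director-hubbard ruling D1 2026-08-30 (BONDBS-KTPLAN-g26 §2/§4): A = the GM₃ chain's reachable range
(helpers of stmt-19089 attach to A), B = residual M ∈ {4,6,8} (M = 4 PROVED:
FourTorus.ferroSideChord_four), C = residual endpoints (Δ = 1 PROVED: FerroPointValue; Δ = 0 by
finite-dimensional continuity of the Perron sector ground state). Nothing here proves
superconductivity in the Hubbard model. -/
@[route_item "route-HubbardSuperconductivity-AnisotropyChord"]
def FerroSideChordOfPieces : Prop :=
  FerroSideChordLarge → FerroSideChordSmall → FerroSideChordEndpoints → FerroSideChord

/-- item stmt-HubbardSuperconductivity-0905 · support · rank 9 · open · by planner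
sources: YaoTsaiKivelson2007, TsaiKivelson2006, KLS1988PRL
[crux] ANCHOR THEOREM (cards plaquette-boson-kls-anchor A1–A3 with δ freed by monotone depletion).
H_L(t',U) := `hamiltonian G_intra 1 U + hamiltonian G_inter t' 0` on Fock((ℤ/Lℤ)²), G_intra = n.n.
bonds inside the 2×2 blocks {2a,2a+1}×{2b,2b+1} (fermionTorusGraph 2 L minus SimpleGraph.comap
(plaquette label x ↦ (⌊x₀/2⌋,⌊x₁/2⌋)) ⊤), G_inter = the remaining n.n. bonds (hopping t', no second
U); H_L(1,U) = hubbardTorus 2 L 1 U. CLAIM: ∃ U>0, δ∈(0,1/2), t₀>0 ∀ t'∈(0,t₀) ∃ c>0: for all large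
L ∈ 4ℕ every normalised (N_L,S^z=0)-sector GS of H_L(t',U), N_L = 2⌊(1−δ)L²/2⌋, has Re⟨ψ, Δ_d†Δ_d ψ⟩
≥ cL⁴ (Δ_d = pairField dWaveFormFactor L, the summit's own operator; L ∈ 4ℕ because RP on the
(L/2)-plaquette torus needs even side). INTENDED SECOND LAYER (glue, filed at the first split): (i)
certified ED of one/two plaquettes: pair binding Δ_pb(U) > 0, B1g selection rule, J(U), V(U),
Δ_eff(U) = −V/2J for U in an explicit interval below U_s ≈ 2.7; (ii) second-order Schrieffer–Wolff
H_L(t',U) ≅ H_XXZ(J t'², Δ_eff) ⊕ high sector + R, ‖R‖ = O(t'³/Δ_pb²) per site; (iii)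
PbHalfFilledXYOrder(Δ_eff) + PbMonotoneDepletion ⇒ (PbInterpolation) boson condensate ≥
2·(2δ)·c·(L/2)⁴ at boson filling 2δ ≤ 1/2; (i -/
@[route_item "route-HubbardSuperconductivity-AnisotropyChord", crux]
def AnchorOrder : Prop :=
  ∃ U : ℝ, 0 < U ∧ ∃ δ ∈ Set.Ioo (0:ℝ) (1/2), ∃ t₀ : ℝ, 0 < t₀ ∧ ∀ t' ∈ Set.Ioo (0:ℝ) t₀, ∃ c : ℝ, 0 < c ∧ ∃ L₀ : ℕ, ∀ (L : ℕ) [NeZero L], L₀ ≤ L → 4 ∣ L → ∀ (N : ℕ) (ψ : Literature.MathematicalPhysics.QuantumLattice.Fock (Literature.MathematicalPhysics.QuantumLattice.Orb (Literature.MathematicalPhysics.QuantumLattice.FermionTorus 2 L))), N = 2 * ⌊(1 - δ) * (L : ℝ) ^ 2 / 2⌋₊ → star ψ ⬝ᵥ ψ = 1 → Literature.MathematicalPhysics.QuantumLattice.IsGroundStateInSector (Literature.MathematicalPhysics.QuantumLattice.hamiltonian ((Literature.MathematicalPhysics.QuantumLattice.fermionTorusGraph 2 L) \ SimpleGraph.comap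 (fun x : Literature.MathematicalPhysics.QuantumLattice.FermionTorus 2 L => fun i : Fin 2 => ((ofLex x) i : ℕ) / 2) ⊤) 1 U + Literature.MathematicalPhysics.QuantumLattice.hamiltonian ((Literature.MathematicalPhysics.QuantumLattice.fermionTorusGraph 2 L) ⊓ SimpleGraph.comap (fun x : Literature.MathematicalPhysics.QuantumLattice.FermionTorus 2 L => fun i : Fin 2 => ((ofLex x) i : ℕ) / 2) ⊤) t' 0) N 0 ψ → c * (L : ℝ) ^ 4 ≤ (Literature.MathematicalPhysics.QuantumLattice.expect ((Literature.MathematicalPhysics.QuantumLattice.pairField Literature.MathematicalPhysics.QuantumLattice.dWaveFormFactor L)ᴴ * Literature.MathematicalPhysics.QuantumLattice.pairField Literature.MathematicalPhysics.QuantumLattice.dWaveFormFactor L) ψ).re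

/-- item stmt-HubbardSuperconductivity-0906 · support · rank 9 · open · by planner
sources: KLS1988PRL, KuboKishi1988, doi:10.1143/jpsj.58.1027, doi:10.1051/jp1:1991109
[crux] HALF-FILLED XY ORDER of the S=½ ferro-XY/AF-Ising torus model on the whole easy-plane
interval Δ ∈ (−1,0] (input (A) of monotone depletion; engine = card uv-ir-handshake-lp-kls): every
normalised S^z_tot = 0 ground state ψ of `xxzHamiltonian 1 (torusGraph 2 M) (-1) Δ` on large even
tori has ⟨ψ, S⁺_tot S⁻_tot ψ⟩ ≥ c(Δ)·M⁴. KNOWN: |Δ| ≲ 0.2 by reflection positivity + Gaussian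
domination + the KLS T=0 sum-rule closure (Kennedy–Lieb–Shastry 1988, Kubo–Kishi 1988; tree:
kls_xy_infraredBound_ground_holds, kennedy_lieb_shastry_xy_ground at Δ = 0 for the tracial
ground-state functional — the S^z=0-sector form here needs the sector identification, routine by
Perron–Frobenius). NEEDED by the route: Δ = Δ_eff(U) ≈ −0.99 (0.7–1.4 % on the easy-plane side of
the Heisenberg point, where xy order is physically healthy, m ≈ 0.3, but the IR-bound closure has
O(1) slack). PROPOSED ENGINE: the linear programme over the structure factor g(k) ≥ 0 with rows {KLS
infrared bound g(k) ≤ B_e(k), sum rule, SDP-certified two-sided intervals for the short-range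
correlators C(r), |r| ≤ R (Wang et al. PRX 2024; symmetry bootstrap arXiv:2410.00810)}, monotone in
R with KLS as the R = 0 vertex, dual = an ex -/
@[route_item "route-HubbardSuperconductivity-AnisotropyChord", crux]
def HalfFilledOrder : Prop :=
  ∀ Δ ∈ Set.Ioc (-1:ℝ) 0, ∃ c : ℝ, 0 < c ∧ ∃ M₀ : ℕ, ∀ (M : ℕ) [NeZero M], Even M → M₀ ≤ M → ∀ (ψ : Literature.MathematicalPhysics.QuantumLattice.TensorIndex (Literature.Probability.LatticeModels.TorusSite 2 M) 2 → ℂ), ψ ∈ Literature.MathematicalPhysics.QuantumLattice.spinZSector (Λ := Literature.Probability.LatticeModels.TorusSite 2 M) 1 0 → star ψ ⬝ᵥ ψ = 1 → Matrix.mulVec (Literature.MathematicalPhysics.QuantumLattice.xxzHamiltonian 1 (Literature.Probability.LatticeModels.torusGraph 2 M) (-1) Δ) ψ = ((Literature.MathematicalPhysics.QuantumLattice.lowestEnergyInSector 1 (Literature.MathematicalPhysics.QuantumLattice.xxzHamiltonian 1 (Literature.Probability.LatticeModels.torusGraph 2 M) (-1) Δ) 0 : ℝ) : ℂ) • ψ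 → c * (M : ℝ) ^ 4 ≤ (star ψ ⬝ᵥ Matrix.mulVec ((∑ x : Literature.Probability.LatticeModels.TorusSite 2 M, Literature.MathematicalPhysics.QuantumLattice.onSite x (Literature.MathematicalPhysics.QuantumLattice.spinRaise 1)) * (∑ y : Literature.Probability.LatticeModels.TorusSite 2 M, Literature.MathematicalPhysics.QuantumLattice.onSite y (Literature.MathematicalPhysics.QuantumLattice.spinLower 1))) ψ).re

/-- item stmt-HubbardSuperconductivity-0977 · support · rank 9 · closed · proved by Summit.HubbardSuperconductivity.HubbardSuperconductivity.Theorems.AnisotropyChord.sectorAnchorXY_proof @ f2913ae0ec53 (prover) · by planner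
sources: KLS1988PRL, AizenmanEtAl2004, LiebSeiringerSolovejYngvason2005, LiebMattis1962, Literature.MathematicalPhysics.QuantumLattice.kennedy_lieb_shastry_xy_ground_holds
[support, provable now; contributed by planner-plancards-…-a5da44b83f-0 after folding its duplicate
route PairBosonDome into this one] THE PROVED ANCHOR IN SECTOR FORM, Δ = 0 only (so that the
all-fillings corollary PbXYAllFillings does not wait for PbHalfFilledXYOrder on the whole interval):
∃ c > 0, M₀: for even M ≥ M₀ every normalised S^z_tot = 0 sector ground state ψ of xxzHamiltonian 1
(torusGraph 2 M) (-1) 0 (= xyTorus 2 M 1 definitionally, rfl) has ⟨ψ, S⁺_tot S⁻_tot ψ⟩ ≥ c·M⁴. Proof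
sketch: Literature.MathematicalPhysics.QuantumLattice.kennedy_lieb_shastry_xy_ground_holds (tree; d
= 2, n = 1) gives liminf_k (2k)⁻⁴ Σ_{x,y} Σ_{α=0,1} ω_GS(S^α_x S^α_y) > 0 for the TRACIAL
ground-state functional; the global ground state of the hard-core gas on the even torus is UNIQUE
with N = |Λ|/2, i.e. lies in S^z_tot = 0 (Aizenman–Lieb–Seiringer–Solovej–Yngvason 2004 =
LiebSeiringerSolovejYngvason2005 ch. 11, held text p.115: 'for U = ∞ the lowest energy is obtained
uniquely for N = ½|Λ|'; KLS1988PRL cite LiebMattis1962 for it), so ω_GS = ⟨ψ, · ψ⟩ for the sector GS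
(unique: stoquastic + connected ⇒ Perron–Frobenius, adapt
LiebMattisSectorPF.sector_perronFrobenius); finally S⁺_tot S⁻_tot = ( -/
@[route_item "route-HubbardSuperconductivity-AnisotropyChord", crux]
def SectorAnchorXY : Prop :=
  ∃ c : ℝ, 0 < c ∧ ∃ M₀ : ℕ, ∀ (M : ℕ) [NeZero M], Even M → M₀ ≤ M → ∀ (ψ : Literature.MathematicalPhysics.QuantumLattice.TensorIndex (Literature.Probability.LatticeModels.TorusSite 2 M) 2 → ℂ), ψ ∈ Literature.MathematicalPhysics.QuantumLattice.spinZSector (Λ := Literature.Probability.LatticeModels.TorusSite 2 M) 1 0 → star ψ ⬝ᵥ ψ = 1 → Matrix.mulVec (Literature.MathematicalPhysics.QuantumLattice.xxzHamiltonian 1 (Literature.Probability.LatticeModels.torusGraph 2 M) (-1) 0) ψ = ((Literature.MathematicalPhysics.QuantumLattice.lowestEnergyInSector 1 (Literature.MathematicalPhysics.QuantumLattice.xxzHamiltonian 1 (Literature.Probability.LatticeModels.torusGraph 2 M) (-1) 0) 0 : ℝ) : ℂ) • ψ → c * (M : ℝ) ^ 4 ≤ (star ψ ⬝ᵥ Matrix.mulVec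 ((∑ x : Literature.Probability.LatticeModels.TorusSite 2 M, Literature.MathematicalPhysics.QuantumLattice.onSite x (Literature.MathematicalPhysics.QuantumLattice.spinRaise 1)) * (∑ y : Literature.Probability.LatticeModels.TorusSite 2 M, Literature.MathematicalPhysics.QuantumLattice.onSite y (Literature.MathematicalPhysics.QuantumLattice.spinLower 1))) ψ).re

-- `SectorAnchorXY` holds: proved by `Summit.HubbardSuperconductivity.HubbardSuperconductivity.Theorems.AnisotropyChord.sectorAnchorXY_proof` @ f2913ae0ec53 (its module imports this route file, so no `_holds` link can be stated here).

/-- item stmt-HubbardSuperconductivity-19090 · support · rank 9 · closed · proved by Summit.HubbardSuperconductivity.HubbardSuperconductivity.Theorems.AnisotropyChord.chordFMOfPieces_proof (prover) · by planner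
sources: KLS1988PRL, doi:10.1007/BF01329865, idea:HubbardSuperconductivity/HubbardSuperconductivity/anisotropy-chord-xxz
[support] SPLIT GLUE of the typed decomposition ChordFM ⇐ ChordXY ∧ FerroSideChord (crux-strategist
cstrat stmt-HubbardSuperconductivity-8147, 2026-08-17; BC2 redirect of the RESTATED re-audit): for Δ
≥ 0 the FM-side chord verbatim; for Δ < 0 take a normalised S^z_tot=0 sector ground state ψ₀ of
H_M(0) (exists: Perron vector of the half-filled hard-core Bose gas,
Theorems.AnisotropyChord.exists_unit_sectorGroundState_xy, landed with ChordToOrderXY),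
FerroSideChord AT Δ = 0 gives the reflection-positivity-free anchor (M²/2)(M²/2+1)/2 ≤ Λ(ψ₀), and
ChordXY transports it: ((1+Δ)/2)S(S+1) = (1+Δ)·(S(S+1)/2) ≤ (1+Δ)Λ(ψ₀) ≤ Λ(ψ). PROVED sorry-free by
the strategist (planners cannot land Theorems): evidence AnisotropyChordChordFMSplit.lean on
stmt-HubbardSuperconductivity-8147 — theorem chordFM_of_chordXY_ferroSideChord, 17 tactic lines
(by_cases on the sign of Δ; obtain ψ₀; anchor; transport; calc), lean check rc 0, axioms
propext/Classical.choice/Quot.sound — a prover lands it verbatim as `theorem … : ChordFMOfPieces`.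
With it ChordFM is DERIVED from the two pieces; the intended `route edit --split ChordFM --into
ChordXY FerroSideChord` is recorded in Cruxes/ChordFM/STRATEGY-CENSUS.md fo -/
@[route_item "route-HubbardSuperconductivity-AnisotropyChord"]
def ChordFMOfPieces : Prop :=
  ChordXY → FerroSideChord → ChordFM

-- `ChordFMOfPieces` holds: proved by `Summit.HubbardSuperconductivity.HubbardSuperconductivity.Theorems.AnisotropyChord.chordFMOfPieces_proof` (its module imports this route file, so no `_holds` link can be stated here).

/-- item stmt-HubbardSuperconductivity-8149 · support · rank 9 · closed · proved by Summit.HubbardSuperconductivity.HubbardSuperconductivity.Theorems.AnisotropyChord.ferroPointValue_proof @ 5a850d04bbdb (prover) · by planner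
sources: doi:10.1007/BF01329865, Tasaki2020, LiebMattis1962
[support] THE EXACT FERROMAGNETIC ENDPOINT (provable now; the Tier B anchor and a convention check):
for every even M (NeZero) every normalised S^z_tot=0 sector GS ψ of H_M(1) = -Σ 𝐒_x·𝐒_y has Λ(ψ) =
(M²/2)(M²/2+1): the sector GS is the unique S_tot = M²/2, S^z = 0 state (each bond -𝐒·𝐒 ≥ -1/4 with
equality iff triplet; connected torus ⇒ fully symmetric; Perron–Frobenius), and S⁺S⁻|S,0⟩ =
S(S+1)|S,0⟩. Tóth 1991: this is also the maximum of ⟨B†B⟩ over the sector. [difficulty: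
provable-now] -/
@[route_item "route-HubbardSuperconductivity-AnisotropyChord", crux]
def FerroPointValue : Prop :=
  ∀ (M : ℕ) [NeZero M], Even M → ∀ (ψ : Literature.MathematicalPhysics.QuantumLattice.TensorIndex (Literature.Probability.LatticeModels.TorusSite 2 M) 2 → ℂ), ψ ∈ Literature.MathematicalPhysics.QuantumLattice.spinZSector (Λ := Literature.Probability.LatticeModels.TorusSite 2 M) 1 0 → star ψ ⬝ᵥ ψ = 1 → Matrix.mulVec (Literature.MathematicalPhysics.QuantumLattice.xxzHamiltonian 1 (Literature.Probability.LatticeModels.torusGraph 2 M) (-1) 1) ψ = ((Literature.MathematicalPhysics.QuantumLattice.lowestEnergyInSector 1 (Literature.MathematicalPhysics.QuantumLattice.xxzHamiltonian 1 (Literature.Probability.LatticeModels.torusGraph 2 M) (-1) 1) 0 : ℝ) : ℂ) • ψ → (star ψ ⬝ᵥ Matrix.mulVec ((∑ x : Literature.Probability.LatticeModels.TorusSite 2 M, Literature.MathematicalPhysics.QuantumLattice.onSite x (Literature.MathematicalPhysics.QuantumLattice.spinRaise 1)) * (∑ y : Literature.Probability.LatticeModels.TorusSite 2 M, Literature.MathematicalPhysics.QuantumLattice.onSite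 y (Literature.MathematicalPhysics.QuantumLattice.spinLower 1))) ψ).re = (M : ℝ) ^ 2 / 2 * ((M : ℝ) ^ 2 / 2 + 1)

-- `FerroPointValue` holds: proved by `Summit.HubbardSuperconductivity.HubbardSuperconductivity.Theorems.AnisotropyChord.ferroPointValue_proof` @ 5a850d04bbdb (its module imports this route file, so no `_holds` link can be stated here).

/-- item stmt-HubbardSuperconductivity-8150 · support · rank 9 · open · by planner
sources: doi:10.1063/1.1665211, doi:10.1007/bf01009750, idea:HubbardSuperconductivity/HubbardSuperconductivity/anisotropy-chord-xxz
[support] THE STRUCTURAL PARENT (CC) (card): for every even M ≥ 4, Δ ↦ Λ_M(Δ) is CONCAVE on [-1,1] —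
three-point form: -1 ≤ Δ₁ ≤ Δ₂ ≤ Δ₃ ≤ 1, sector GS ψᵢ of H_M(Δᵢ) ⇒ (Δ₃-Δ₂)Λ(ψ₁) + (Δ₂-Δ₁)Λ(ψ₃) ≤
(Δ₃-Δ₁)Λ(ψ₂). Implies ChordXY (points -1, Δ, 0 and Λ ≥ 0) and, with FerroPointValue, ChordFM (points
-1, Δ, 1). Equivalent finite-β form: (log Λ_β)'' = Var_worm(𝒜) - Var_closed(𝒜) ≤ -((log Λ_β)')², 𝒜 =
∫₀^β Σ n_p n_q — the intended proof engine. Filed as support so that a positive second difference at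
some M (which kills (CC) but not necessarily the chords) does not break the route; refuters may
still test it first (it is the sharpest form). [difficulty: open-problem] -/
@[route_item "route-HubbardSuperconductivity-AnisotropyChord", crux]
def Concavity : Prop :=
  ∀ (M : ℕ) [NeZero M], Even M → 4 ≤ M → ∀ (Δ₁ Δ₂ Δ₃ : ℝ), -1 ≤ Δ₁ → Δ₁ ≤ Δ₂ → Δ₂ ≤ Δ₃ → Δ₃ ≤ 1 → ∀ (ψ₁ ψ₂ ψ₃ : Literature.MathematicalPhysics.QuantumLattice.TensorIndex (Literature.Probability.LatticeModels.TorusSite 2 M) 2 → ℂ), ψ₁ ∈ Literature.MathematicalPhysics.QuantumLattice.spinZSector (Λ := Literature.Probability.LatticeModels.TorusSite 2 M) 1 0 → star ψ₁ ⬝ᵥ ψ₁ = 1 → Matrix.mulVec (Literature.MathematicalPhysics.QuantumLattice.xxzHamiltonian 1 (Literature.Probability.LatticeModels.torusGraph 2 M) (-1) Δ₁) ψ₁ = ((Literature.MathematicalPhysics.QuantumLattice.lowestEnergyInSector 1 (Literature.MathematicalPhysics.QuantumLattice.xxzHamiltonian 1 (Literature.Probability.LatticeModels.torusGraph 2 M)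 (-1) Δ₁) 0 : ℝ) : ℂ) • ψ₁ → ψ₂ ∈ Literature.MathematicalPhysics.QuantumLattice.spinZSector (Λ := Literature.Probability.LatticeModels.TorusSite 2 M) 1 0 → star ψ₂ ⬝ᵥ ψ₂ = 1 → Matrix.mulVec (Literature.MathematicalPhysics.QuantumLattice.xxzHamiltonian 1 (Literature.Probability.LatticeModels.torusGraph 2 M) (-1) Δ₂) ψ₂ = ((Literature.MathematicalPhysics.QuantumLattice.lowestEnergyInSector 1 (Literature.MathematicalPhysics.QuantumLattice.xxzHamiltonian 1 (Literature.Probability.LatticeModels.torusGraph 2 M) (-1) Δ₂) 0 : ℝ) : ℂ) • ψ₂ → ψ₃ ∈ Literature.MathematicalPhysics.QuantumLattice.spinZSector (Λ := Literature.Probability.LatticeModels.TorusSite 2 M) 1 0 → star ψ₃ ⬝ᵥ ψ₃ = 1 → Matrix.mulVec (Literature.MathematicalPhysics.QuantumLattice.xxzHamiltonian 1 (Literature.Probability.LatticeModels.torusGraph 2 M) (-1) Δ₃) ψ₃ = ((Literature.MathematicalPhysics.QuantumLattice.lowestEnergyInSector 1 (Literature.MathematicalPhysics.QuantumLattice.xxzHamiltonian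 1 (Literature.Probability.LatticeModels.torusGraph 2 M) (-1) Δ₃) 0 : ℝ) : ℂ) • ψ₃ → (Δ₃ - Δ₂) * (star ψ₁ ⬝ᵥ Matrix.mulVec ((∑ x : Literature.Probability.LatticeModels.TorusSite 2 M, Literature.MathematicalPhysics.QuantumLattice.onSite x (Literature.MathematicalPhysics.QuantumLattice.spinRaise 1)) * (∑ y : Literature.Probability.LatticeModels.TorusSite 2 M, Literature.MathematicalPhysics.QuantumLattice.onSite y (Literature.MathematicalPhysics.QuantumLattice.spinLower 1))) ψ₁).re + (Δ₂ - Δ₁) * (star ψ₃ ⬝ᵥ Matrix.mulVec ((∑ x : Literature.Probability.LatticeModels.TorusSite 2 M, Literature.MathematicalPhysics.QuantumLattice.onSite x (Literature.MathematicalPhysics.QuantumLattice.spinRaise 1)) * (∑ y : Literature.Probability.LatticeModels.TorusSite 2 M, Literature.MathematicalPhysics.QuantumLattice.onSite y (Literature.MathematicalPhysics.QuantumLattice.spinLower 1))) ψ₃).re ≤ (Δ₃ - Δ₁) * (star ψ₂ ⬝ᵥ Matrix.mulVec ((∑ x : Literature.Probability.LatticeModels.TorusSite 2 M, Literature.MathematicalPhysics.QuantumLattice.onSite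 x (Literature.MathematicalPhysics.QuantumLattice.spinRaise 1)) * (∑ y : Literature.Probability.LatticeModels.TorusSite 2 M, Literature.MathematicalPhysics.QuantumLattice.onSite y (Literature.MathematicalPhysics.QuantumLattice.spinLower 1))) ψ₂).re

/-- item stmt-HubbardSuperconductivity-8151 · support · rank 9 · closed · proved by Summit.HubbardSuperconductivity.HubbardSuperconductivity.Theorems.AnisotropyChord.chordToOrderXY_proof @ d0fdc7cdda8e (prover) · by planner
sources: KLS1988PRL, idea:HubbardSuperconductivity/HubbardSuperconductivity/anisotropy-chord-xxz
[support] TIER A GLUE (provable now, ~150 lines): ChordXY → SectorAnchorXY → HalfFilledOrder. Proof: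
given Δ ∈ (-1,0], take c' = (1+Δ)c > 0 and M₀' = max(M₀,4); for even M ≥ M₀' pick a normalised
sector GS ψ₀ of H_M(0) (exists: Hermitian matrix on the nonempty invariant sector, minEnergyOn
attained; cf. LiebMattisSectorPF), then Λ(ψ) ≥ (1+Δ)Λ(ψ₀) ≥ (1+Δ)cM⁴. [difficulty: provable-now] -/
@[route_item "route-HubbardSuperconductivity-AnisotropyChord", crux]
def ChordToOrderXY : Prop :=
  ChordXY → SectorAnchorXY → HalfFilledOrder

-- `ChordToOrderXY` holds: proved by `Summit.HubbardSuperconductivity.HubbardSuperconductivity.Theorems.AnisotropyChord.chordToOrderXY_proof` @ d0fdc7cdda8e (its module imports this route file, so no `_holds` link can be stated here).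

/-- item stmt-HubbardSuperconductivity-8152 · support · rank 9 · closed · proved by Summit.HubbardSuperconductivity.HubbardSuperconductivity.Theorems.AnisotropyChord.chordToOrderFM_proof @ 6a2857ffc284 (prover) · by planner
sources: doi:10.1007/BF01329865, idea:HubbardSuperconductivity/HubbardSuperconductivity/anisotropy-chord-xxz
[support] TIER B GLUE (provable now, ~60 lines): ChordFM → HalfFilledOrder with c = (1+Δ)/8 and M₀ =
4, since (M²/2)(M²/2+1)/2 ≥ M⁴/8. This is the RP-free substitute for ChordXY ∧ SectorAnchorXY in the
Assembly. [difficulty: provable-now] -/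
@[route_item "route-HubbardSuperconductivity-AnisotropyChord", crux]
def ChordToOrderFM : Prop :=
  ChordFM → HalfFilledOrder

-- `ChordToOrderFM` holds: proved by `Summit.HubbardSuperconductivity.HubbardSuperconductivity.Theorems.AnisotropyChord.chordToOrderFM_proof` @ 6a2857ffc284 (its module imports this route file, so no `_holds` link can be stated here).

/-- item stmt-HubbardSuperconductivity-8153 · assembly · rank 1 · closed · proved by Summit.HubbardSuperconductivity.HubbardSuperconductivity.Theorems.AnisotropyChord.anisotropyChord_assembly_proof (prover) · by planner
sources: Scalapino1995, KLS1988PRL, YaoTsaiKivelson2007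
[assembly] ChordXY → SectorAnchorXY → DressHalfFilled → Continuation → HubbardSuperconductivity
(glue ChordToOrderXY + PlaquetteBoson's assembly logic). -/
@[route_item "route-HubbardSuperconductivity-AnisotropyChord", crux]
def Assembly : Prop :=
  ChordXY → SectorAnchorXY → DressHalfFilled → Continuation → HubbardSuperconductivity

-- `Assembly` holds: proved by `Summit.HubbardSuperconductivity.HubbardSuperconductivity.Theorems.AnisotropyChord.anisotropyChord_assembly_proof` (its module imports this route file, so no `_holds` link can be stated here).

/-! D-0027 §2.1 — DECIDING THEOREM (planner-authored via `route open/edit --closes-file`; by operator:999:1754322 2026-08-15T15:04:36Z):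
its hypotheses are this route's items and its conclusion the sub-problem Statement (glue_lint), and it elaborates with this file. -/

@[closes "route-HubbardSuperconductivity-AnisotropyChord"] theorem closes : ChordXY → ChordFM → DressHalfFilled → Continuation → AnchorOrder → HalfFilledOrder → SectorAnchorXY → FerroPointValue → Concavity → ChordToOrderXY → ChordToOrderFM → Assembly → _root_.HubbardSuperconductivity := fun h_ChordXY h_ChordFM h_DressHalfFilled h_Continuation h_AnchorOrder h_HalfFilledOrder h_SectorAnchorXY h_FerroPointValue h_Concavity h_ChordToOrderXY h_ChordToOrderFM h_Assembly => h_Assembly h_ChordXY h_SectorAnchorXY h_DressHalfFilled h_Continuation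

end Summit.HubbardSuperconductivity.HubbardSuperconductivity.Theses.AnisotropyChord
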